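import Literature.Analysis.FluidPDE.WholeSpaceIBP
import Literature.Analysis.FluidPDE.VectorCalculusProofs
import Literature.Analysis.FluidPDE.VorticityCalculus
import Literature.Analysis.FluidPDE.SelfSimilarProofs
import HarnessLib

/-!
# Route `ExtremiserTransience`, crux `NearExtremalTransiencePerFlow` (stmt-NavierStokesRegularity-26567) —
# LINE g11-α «Leray pincer» (ns-idea-5 g11): THE SEA IDENTITY (step (ii) of the static stub T `TightOfBoundedBudget`)

`--supports stmt-NavierStokesRegularity-26567` (helper; prover seat ns-net-p2 g11).  `integral_cutoff_stretching_eq`: for `v ∈ C²(ℝ³; ℝ³)`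
(no divergence condition needed), `ω = curl v`, and a `C¹` compactly supported cut-off `ζ`,
`∫ ζ ⟪ω, Dv ω⟫ = −∫ ζ ⟪v, Dω ω⟫ − ∫ Dζ(ω) ⟪v, ω⟫` — the divergence theorem without boundary (`integral_divergence_eq_zero`) for the
compactly supported `C¹` field `(ζ ⟪v, ω⟫) ω`, with `div ω = 0` (`divergence_curl_eq_zero_holds`) and the Leibniz rule
(`divergence_smul_apply`).  This is the «sea identity» of the line's card (mechanism (ii): it prices the vortex stretching carried by a
region where `‖v‖` is small by `‖v‖` itself, at the cost of `∇ζ` boundary terms).  Elementary; T, Q♭, ⟨26567⟩ and NS regularity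
remain OPEN; no summit is proved by a line. [cite: MajdaBertozziCUP2002, §1.1 (vector identities)] [folklore]
-/

noncomputable section

open scoped Topology InnerProductSpace RealInnerProductSpace ContDiff
open MeasureTheory Filter Set Metric Function InnerProductSpace
open Literature.Analysis Literature.Analysis.FluidPDE

namespace Summit.NavierStokesRegularity.NavierStokesRegularity.Theorems

-- the problem directory repeats the summit name (`NavierStokesRegularity/NavierStokesRegularity`)
set_option linter.dupNamespace false

namespace NearExtremalTransiencePerFlow.LerayPincer

/-- **The sea identity** (vortex stretching against a cut-off is a boundary/transport term).  For `v ∈ C²(ℝ³; ℝ³)` (any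
divergence), `ω = curl v`, and a `C¹` compactly supported cut-off `ζ`:
`∫ ζ ⟪ω, Dv ω⟫ = −∫ ζ ⟪v, Dω ω⟫ − ∫ Dζ(ω) ⟪v, ω⟫` — the divergence theorem for the compactly supported field
`(ζ ⟪v, ω⟫) ω`, using only `div ω = 0`.  (The «sea identity» of LINE g11-α `leray_pincer`: it prices the stretching carried by a region
where `‖v‖` is small by `‖v‖` itself.) [folklore] -/
theorem integral_cutoff_stretching_eq {v : EuclideanSpace ℝ (Fin 3) → EuclideanSpace ℝ (Fin 3)} {ζ : EuclideanSpace ℝ (Fin 3) → ℝ}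
    (hv : ContDiff ℝ 2 v) (hζ : ContDiff ℝ 1 ζ) (hζc : HasCompactSupport ζ) :
    ∫ x, ζ x * ⟪curl v x, fderiv ℝ v x (curl v x)⟫_ℝ =
      -(∫ x, ζ x * ⟪v x, fderiv ℝ (curl v) x (curl v x)⟫_ℝ) - ∫ x, fderiv ℝ ζ x (curl v x) * ⟪v x, curl v x⟫_ℝ := by
  have hv1 : ContDiff ℝ 1 v := hv.of_le one_le_two
  have hω1 : ContDiff ℝ 1 (curl v) := contDiff_curl (n := 1) (by exact_mod_cast hv)
  -- the scalar `θ = ζ ⟪v, ω⟫` and the field `F = θ ω`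
  set θ : EuclideanSpace ℝ (Fin 3) → ℝ := fun y => ζ y * ⟪v y, curl v y⟫_ℝ with hθ
  have hθ1 : ContDiff ℝ 1 θ := hζ.mul (hv1.inner ℝ hω1)
  have hθc : HasCompactSupport θ := hζc.mul_right
  set F : EuclideanSpace ℝ (Fin 3) → EuclideanSpace ℝ (Fin 3) := fun y => θ y • curl v y with hF
  have hF1 : ContDiff ℝ 1 F := hθ1.smul hω1
  have hFc : HasCompactSupport F := hθc.smul_right
  -- pointwise divergence
  have hdivω : ∀ x, VectorCalculus.divergence (curl v) x = 0 := fun x => divergence_curl_eq_zero_holds v hv x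
  have hDθ : ∀ x a, fderiv ℝ θ x a = fderiv ℝ ζ x a * ⟪v x, curl v x⟫_ℝ +
      ζ x * (⟪fderiv ℝ v x a, curl v x⟫_ℝ + ⟪v x, fderiv ℝ (curl v) x a⟫_ℝ) := by
    intro x a
    have hζd : DifferentiableAt ℝ ζ x := hζ.differentiable one_ne_zero x
    have hvd : DifferentiableAt ℝ v x := hv1.differentiable one_ne_zero x
    have hωd : DifferentiableAt ℝ (curl v) x := hω1.differentiable one_ne_zero x
    have hid : DifferentiableAt ℝ (fun y => ⟪v y, curl v y⟫_ℝ) x := hvd.inner ℝ hωd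
    rw [hθ, fderiv_fun_mul hζd hid]
    simp only [_root_.add_apply, FunLike.coe_smul, Pi.smul_apply, smul_eq_mul]
    rw [fderiv_inner_apply ℝ hvd hωd]
    ring
  have hdivF : ∀ x, VectorCalculus.divergence F x = fderiv ℝ ζ x (curl v x) * ⟪v x, curl v x⟫_ℝ +
      ζ x * (⟪fderiv ℝ v x (curl v x), curl v x⟫_ℝ + ⟪v x, fderiv ℝ (curl v) x (curl v x)⟫_ℝ) := by
    intro x
    rw [hF, divergence_smul_apply (hθ1.differentiable one_ne_zero x) (hω1.differentiable one_ne_zero x), hdivω x, mul_zero,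
      zero_add, real_inner_gradient_right, hDθ x (curl v x)]
  -- integrate
  have hint0 := integral_divergence_eq_zero hF1 hFc
  simp_rw [hdivF] at hint0
  have hcont1 : Continuous fun x => fderiv ℝ ζ x (curl v x) * ⟪v x, curl v x⟫_ℝ :=
    ((hζ.continuous_fderiv one_ne_zero).clm_apply hω1.continuous).mul (hv1.continuous.inner hω1.continuous)
  have hcont2 : Continuous fun x => ζ x * ⟪fderiv ℝ v x (curl v x), curl v x⟫_ℝ :=
    hζ.continuous.mul (((hv1.continuous_fderiv one_ne_zero).clm_apply hω1.continuous).inner hω1.continuous)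
  have hcont3 : Continuous fun x => ζ x * ⟪v x, fderiv ℝ (curl v) x (curl v x)⟫_ℝ :=
    hζ.continuous.mul (hv1.continuous.inner ((hω1.continuous_fderiv one_ne_zero).clm_apply hω1.continuous))
  have hK1 : IsCompact (tsupport (fderiv ℝ ζ)) := hζc.fderiv (𝕜 := ℝ)
  have hK0 : IsCompact (tsupport ζ) := hζc
  have hs1 : HasCompactSupport (fun x => fderiv ℝ ζ x (curl v x) * ⟪v x, curl v x⟫_ℝ) :=
    HasCompactSupport.intro hK1 fun x hx => by rw [image_eq_zero_of_notMem_tsupport hx]; simp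
  have hs2 : HasCompactSupport (fun x => ζ x * ⟪fderiv ℝ v x (curl v x), curl v x⟫_ℝ) :=
    HasCompactSupport.intro hK0 fun x hx => by rw [image_eq_zero_of_notMem_tsupport hx]; simp
  have hs3 : HasCompactSupport (fun x => ζ x * ⟪v x, fderiv ℝ (curl v) x (curl v x)⟫_ℝ) :=
    HasCompactSupport.intro hK0 fun x hx => by rw [image_eq_zero_of_notMem_tsupport hx]; simp
  have hi1 : Integrable (fun x => fderiv ℝ ζ x (curl v x) * ⟪v x, curl v x⟫_ℝ) (volume : Measure (EuclideanSpace ℝ (Fin 3))) :=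
    hcont1.integrable_of_hasCompactSupport hs1
  have hi2 : Integrable (fun x => ζ x * ⟪fderiv ℝ v x (curl v x), curl v x⟫_ℝ) (volume : Measure (EuclideanSpace ℝ (Fin 3))) :=
    hcont2.integrable_of_hasCompactSupport hs2
  have hi3 : Integrable (fun x => ζ x * ⟪v x, fderiv ℝ (curl v) x (curl v x)⟫_ℝ) (volume : Measure (EuclideanSpace ℝ (Fin 3))) :=
    hcont3.integrable_of_hasCompactSupport hs3
  have hsplit : ∫ x, (fderiv ℝ ζ x (curl v x) * ⟪v x, curl v x⟫_ℝ +
      ζ x * (⟪fderiv ℝ v x (curl v x), curl v x⟫_ℝ + ⟪v x, fderiv ℝ (curl v) x (curl v x)⟫_ℝ)) =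
      (∫ x, fderiv ℝ ζ x (curl v x) * ⟪v x, curl v x⟫_ℝ) +
        ((∫ x, ζ x * ⟪fderiv ℝ v x (curl v x), curl v x⟫_ℝ) + ∫ x, ζ x * ⟪v x, fderiv ℝ (curl v) x (curl v x)⟫_ℝ) := by
    have e2 : (∫ x, (ζ x * ⟪fderiv ℝ v x (curl v x), curl v x⟫_ℝ + ζ x * ⟪v x, fderiv ℝ (curl v) x (curl v x)⟫_ℝ)) =
        (∫ x, ζ x * ⟪fderiv ℝ v x (curl v x), curl v x⟫_ℝ) + ∫ x, ζ x * ⟪v x, fderiv ℝ (curl v) x (curl v x)⟫_ℝ :=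
      integral_add hi2 hi3
    have e1 : (∫ x, (fderiv ℝ ζ x (curl v x) * ⟪v x, curl v x⟫_ℝ +
        (ζ x * ⟪fderiv ℝ v x (curl v x), curl v x⟫_ℝ + ζ x * ⟪v x, fderiv ℝ (curl v) x (curl v x)⟫_ℝ))) =
        (∫ x, fderiv ℝ ζ x (curl v x) * ⟪v x, curl v x⟫_ℝ) +
          ∫ x, (ζ x * ⟪fderiv ℝ v x (curl v x), curl v x⟫_ℝ + ζ x * ⟪v x, fderiv ℝ (curl v) x (curl v x)⟫_ℝ) :=
      integral_add hi1 (hi2.add hi3)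
    rw [← e2, ← e1]
    refine integral_congr_ae (Eventually.of_forall fun x => ?_)
    show fderiv ℝ ζ x (curl v x) * ⟪v x, curl v x⟫_ℝ +
      ζ x * (⟪fderiv ℝ v x (curl v x), curl v x⟫_ℝ + ⟪v x, fderiv ℝ (curl v) x (curl v x)⟫_ℝ) = _
    ring
  rw [hsplit] at hint0
  have hsym : ∫ x, ζ x * ⟪curl v x, fderiv ℝ v x (curl v x)⟫_ℝ = ∫ x, ζ x * ⟪fderiv ℝ v x (curl v x), curl v x⟫_ℝ :=
    integral_congr_ae (Eventually.of_forall fun x => by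
      show ζ x * ⟪curl v x, fderiv ℝ v x (curl v x)⟫_ℝ = ζ x * ⟪fderiv ℝ v x (curl v x), curl v x⟫_ℝ
      rw [real_inner_comm])
  rw [hsym]
  linarith

end NearExtremalTransiencePerFlow.LerayPincer

end Summit.NavierStokesRegularity.NavierStokesRegularity.Theorems

end
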